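import Summits.FinalStateConjecture.FinalStateConjecture.Theorems.ZeroEnergyKerrOrBombSymplecticDualOfTheBombSig4
import Summits.FinalStateConjecture.FinalStateConjecture.Theorems.ZeroEnergyKerrOrBombStationaryLimitReductionStubKerrIsometryRigidity
import Summits.FinalStateConjecture.FinalStateConjecture.Theorems.ZeroEnergyKerrOrBombStationaryLimitReductionKerrChartedOpenEmbedding
import Literature.Geometry.Lorentzian.IsometricImmersionExp
import Literature.Geometry.Lorentzian.ConnectionNaturality
import Literature.Geometry.Lorentzian.StationaryBlackHoleUniquenessProofs
import Literature.Geometry.Lorentzian.KerrStationaryBlackHole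
import Literature.Geometry.Lorentzian.CausalityOpennessProofs
import HarnessLib

/-!
# Route ZeroEnergyKerrOrBomb · crux `StationaryLimitReduction` (stmt-FinalStateConjecture-10021), line
# `symplectic-dual-of-the-bomb` — stub 1R `kerrIsometryRigidity`, wave 3: the chart reading
# `Θ₀ = A⁻¹ ∘ Ψ` of the RAW Kerr isometry and the chart preimage `P` of the d.o.c.

Helper file (`--supports stmt-FinalStateConjecture-10021`; registered helper `kerrChartMap_clauses`) of the
lead's wave-3 stub-worker for `stub_kerrIsometryRigidity` (lead prover-line-stmt-FinalStateConjecture-10021-a2-0,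
2026-08-16). First of the files proving the END-MATCHING obligation F0 (`KerrEndMatching` of
`…KerrIsometryRigidityWave3Facts`) from the two Killing-algebra facts; this one is fact-free.

Setting: `𝓑` a stationary black hole, `A` an adapted chart with injective differentials,
`Ψ : Kerr.exterior M a → 𝓑` an injective isometric immersion of the smooth Kerr exterior onto `𝓑.doc`
(the datum of `IsKerrExterior`), with NO equivariance known yet (the pulled-back Killing field
`Y = Ψ^*T` is not yet identified — that identification is what end matching feeds).

* §1 `kerrExtend Ψ` (the extension of `Ψ` by a junk value to `E4`) and `kerrChartMap A Ψ := chartPreimage A ∘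
  kerrExtend Ψ` (`Θ₀`); `kerrChartMap_clauses` (registered): `Θ₀` is `C^∞` and injective on the exterior,
  valued in `A.domain`, isometric from `Kerr.bilin M a` to `A.bilin`, anchored
  (`Θ₀ '' exterior = P := {u | ∃ h : u ∈ A.domain, A ⟨u, h⟩ ∈ 𝓑.doc}`), `A (Θ₀ x) = Ψ x`, and maps the
  pulled-back Killing field to the chart time direction: `DΘ₀ (Y x) = e₀` — the `c`-free part of
  `kerrChartedClauses_of_chartedExtension` (p116587), proof adapted from it;
* §2 the chart preimage `P` of the d.o.c.: it is invariant under chart-time translation (the chart lines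
  `s ↦ A (u + s e₀)` are integral curves of `T`, which preserve the d.o.c., `mem_doc_of_isMIntegralCurve`), it
  contains the far cylinder `{‖y‖ ≥ R₀}` of an asymptotically Schwarzschildean chart, and it is not all of `E4`
  when the (non-empty) horizon is charted by `A`.

References: B. O'Neill, *Semi-Riemannian Geometry* (1983), Ch. 1 (Thm. 1.16), Ch. 3 (pp. 58–59, 90–91),
Ch. 9 (Prop. 9.25); P. T. Chruściel, J. L. Costa, arXiv:0806.0016, §2.2.
-/

set_option linter.dupNamespace false

noncomputable section

open scoped Manifold ContDiff Topology
open Set Filter Function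

namespace Summit.FinalStateConjecture.FinalStateConjecture.Theorems.SymplecticDualOfTheBomb

open Literature.Geometry.Lorentzian Literature.Geometry.Manifold

/-! ## §1 The chart reading `Θ₀ = A⁻¹ ∘ Ψ` of the raw Kerr isometry -/

section ChartMap

variable {𝓑 : StationaryAFBlackHole.{0}} {M a : ℝ}

/-- A fixed point of the (non-empty) Kerr exterior, used as the junk value of `kerrExtend`. [folklore] -/
def extPoint (M a : ℝ) : Kerr.exterior M a :=
  ⟨(kerrRegion_nonempty a (Kerr.rPlus M a)).some, (kerrRegion_nonempty a (Kerr.rPlus M a)).some_mem⟩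

open Classical in
/-- The extension of `Ψ : Kerr.exterior M a → 𝓑` to a total map `E4 → 𝓑` (junk value off the
exterior). [folklore] -/
def kerrExtend (Ψ : Kerr.exterior M a → 𝓑.carrier) : E4 → 𝓑.carrier :=
  fun x ↦ if h : x ∈ (Kerr.exterior M a : Set E4) then Ψ ⟨x, h⟩ else Ψ (extPoint M a)

/-- On the exterior `kerrExtend Ψ` is `Ψ`. [folklore] -/
theorem kerrExtend_apply (Ψ : Kerr.exterior M a → 𝓑.carrier) (x : Kerr.exterior M a) :
    kerrExtend Ψ x.1 = Ψ x :=
  dif_pos (show (x : E4) ∈ (Kerr.exterior M a : Set E4) from x.2)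

/-- `kerrExtend Ψ ∘ (inclusion) = Ψ`. [folklore] -/
theorem kerrExtend_comp_subtypeVal (Ψ : Kerr.exterior M a → 𝓑.carrier) :
    kerrExtend Ψ ∘ (Subtype.val : Kerr.exterior M a → E4) = Ψ :=
  funext fun x ↦ kerrExtend_apply Ψ x

/-- The image of the exterior under `kerrExtend Ψ` is the range of `Ψ`. [folklore] -/
theorem kerrExtend_image (Ψ : Kerr.exterior M a → 𝓑.carrier) :
    kerrExtend Ψ '' (Kerr.exterior M a : Set E4) = Set.range Ψ := by
  rw [Set.image_eq_range]
  exact congrArg Set.range (kerrExtend_comp_subtypeVal Ψ)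

/-- **The chart reading of the raw Kerr isometry**: `Θ₀ := chartPreimage A ∘ kerrExtend Ψ`
(`A⁻¹ ∘ Ψ` on the exterior, junk elsewhere). O'Neill 1983, Ch. 1, pp. 1–5. [folklore] -/
def kerrChartMap (A : 𝓑.AdaptedChart) (Ψ : Kerr.exterior M a → 𝓑.carrier) : E4 → E4 :=
  fun x ↦ chartPreimage A (kerrExtend Ψ x)

/-- `kerrExtend Ψ` is smooth on the exterior and its differential there is that of `Ψ`
(the inclusion of the open exterior has identity differential). [folklore] -/
theorem contMDiffOn_kerrExtend {Ψ : Kerr.exterior M a → 𝓑.carrier}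
    (hΨ : ContMDiff 𝓘(ℝ, E4) (𝓡 4) ∞ Ψ) :
    ContMDiffOn 𝓘(ℝ, E4) (𝓡 4) ∞ (kerrExtend Ψ) (Kerr.exterior M a : Set E4) ∧
      ∀ x : Kerr.exterior M a, ∀ v : E4,
        mfderiv 𝓘(ℝ, E4) (𝓡 4) (kerrExtend Ψ) x.1 v = mfderiv 𝓘(ℝ, E4) (𝓡 4) Ψ x v := by
  have hs : ContMDiffOn 𝓘(ℝ, E4) (𝓡 4) ∞ (kerrExtend Ψ) (Kerr.exterior M a : Set E4) := by
    intro x hx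
    have h : ContMDiffAt 𝓘(ℝ, E4) (𝓡 4) ∞ (fun y : Kerr.exterior M a ↦ kerrExtend Ψ y.1) ⟨x, hx⟩ := by
      have h' : (fun y : Kerr.exterior M a ↦ kerrExtend Ψ y.1) = Ψ := kerrExtend_comp_subtypeVal Ψ
      rw [h']; exact hΨ _
    exact (contMDiffAt_subtype_iff.1 h).contMDiffWithinAt
  refine ⟨hs, fun x v ↦ ?_⟩
  have hΦd : MDifferentiableAt 𝓘(ℝ, E4) (𝓡 4) (kerrExtend Ψ) x.1 :=
    (hs.contMDiffAt ((Kerr.exterior M a).isOpen.mem_nhds x.2)).mdifferentiableAt (by simp)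
  have h := mfderiv_comp x hΦd (OpenSubmanifold.mdifferentiableAt_subtype_val (I := 𝓘(ℝ, E4)) x)
  rw [OpenSubmanifold.mfderiv_subtype_val, kerrExtend_comp_subtypeVal] at h
  rw [h]
  rfl

/-- **Registered helper `kerrChartMap_clauses`** (the `c`-free part of
`kerrChartedClauses_of_chartedExtension`, p116587, for the RAW isometry). Let `A` be an adapted chart with
injective differentials and `Ψ` an injective isometric immersion of the smooth Kerr exterior (`|a| < M`) into
`𝓑` with range `𝓑.doc`. Then `Θ₀ := kerrChartMap A Ψ` is `C^∞` and injective on the exterior, maps it into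
`A.domain`, is isometric there from `Kerr.bilin M a` to `A.bilin`, is anchored (`Θ₀ '' exterior` = the chart
preimage of the d.o.c.), reads back through the chart (`A (Θ₀ x) = Ψ x`), and sends the pulled-back Killing
field `Y = Ψ^*T` to the chart time direction: `DΘ₀ (Y x) = e₀` (`dA ∘ DΘ₀ = dΨ`, `dΨ Y = T = dA e₀`, `dA`
injective). Proof adapted from `kerrChartedClauses_of_chartedExtension`: the explicit map agrees on the
exterior with `A.symm ∘ kerrExtend Ψ`, smooth by the inverse function theorem
(`contMDiffOn_adaptedChart_symm`, p104678). O'Neill 1983, Ch. 1, Thm. 1.16; Ch. 3, pp. 58–59.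
[folklore] -/
theorem kerrChartMap_clauses : ∀ [Kerr.Facts] (𝓑 : StationaryAFBlackHole.{0}) (A : 𝓑.AdaptedChart) (M a : ℝ) (Ψ : Kerr.exterior M a → 𝓑.carrier), (∀ x : A.domain, Function.Injective (mfderiv 𝓘(ℝ, E4) (𝓡 4) A.toFun x)) → Function.Injective Ψ → Set.range Ψ = 𝓑.doc → PseudoRiemannianMetric.IsIsometricImmersion (Kerr.smoothMetric M a (Kerr.rPlus M a)).toPseudoRiemannianMetric 𝓑.metric.toPseudoRiemannianMetric Ψ → ContDiffOn ℝ ∞ (kerrChartMap A Ψ) (Kerr.exterior M a : Set E4) ∧ Set.InjOn (kerrChartMap A Ψ) (Kerr.exterior M a : Set E4) ∧ Set.MapsTo (kerrChartMap A Ψ) (Kerr.exterior M a : Set E4) (A.domain : Set E4) ∧ (∀ x ∈ (Kerr.exterior M a : Set E4), ∀ v w : E4, A.bilin (kerrChartMap A Ψ x) (fderiv ℝ (kerrChartMap A Ψ) x v) (fderiv ℝ (kerrChartMap A Ψ) x w) = Kerr.bilin M a x v w) ∧ kerrChartMap A Ψ '' (Kerr.exterior M a : Set E4) = {u : E4 |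 ∃ h : u ∈ A.domain, A.toFun ⟨u, h⟩ ∈ 𝓑.doc} ∧ (∀ x : Kerr.exterior M a, ∃ h : kerrChartMap A Ψ x.1 ∈ A.domain, A.toFun ⟨kerrChartMap A Ψ x.1, h⟩ = Ψ x) ∧ ∀ x : Kerr.exterior M a, fderiv ℝ (kerrChartMap A Ψ) x.1 (VectorField.mpullback 𝓘(ℝ, E4) (𝓡 4) Ψ 𝓑.killing x) = E4.basisVector 0 := by
  intro _ 𝓑 A M a Ψ hA hΨi hΨr hΨiso
  -- adapted from `kerrChartedClauses_of_chartedExtension` (p116587): same construction, no equivariance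
  set Φ : E4 → 𝓑.carrier := kerrExtend Ψ with hΦ_def
  set S : Set E4 := (Kerr.exterior M a : Set E4) with hS
  have hSo : IsOpen S := (Kerr.exterior M a).isOpen
  obtain ⟨hΦs, hΦmf⟩ := contMDiffOn_kerrExtend (M := M) (a := a) (Ψ := Ψ) hΨiso.1
  have hΦr : Set.MapsTo Φ S (Set.range A.toFun) := by
    intro x hx
    refine A.doc_subset_range ?_
    rw [← hΨr, ← kerrExtend_image Ψ]
    exact Set.mem_image_of_mem _ hx
  have hΦi : Set.InjOn Φ S := by
    intro x hx y hy hxy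
    have h : Ψ ⟨x, hx⟩ = Ψ ⟨y, hy⟩ := by
      rwa [← kerrExtend_apply Ψ ⟨x, hx⟩, ← kerrExtend_apply Ψ ⟨y, hy⟩]
    exact congrArg Subtype.val (hΨi h)
  -- the chart domain is nonempty
  obtain ⟨u₀, -⟩ := hΦr (extPoint M a).2
  haveI : Nonempty A.domain := ⟨u₀⟩
  -- the smooth inverse `g = A⁻¹` on `range A`
  set g : 𝓑.carrier → A.domain := ⇑(A.isOpenEmbedding.toOpenPartialHomeomorph A.toFun).symm with hg
  have hgA : ∀ u : A.domain, g (A.toFun u) = u := fun u ↦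
    A.isOpenEmbedding.toOpenPartialHomeomorph_left_inv A.toFun
  have hAg : ∀ p ∈ Set.range A.toFun, A.toFun (g p) = p := fun p hp ↦
    A.isOpenEmbedding.toOpenPartialHomeomorph_right_inv A.toFun hp
  have hgs : ContMDiffOn (𝓡 4) 𝓘(ℝ, E4) ∞ g (Set.range A.toFun) :=
    contMDiffOn_adaptedChart_symm A hA
  set Ψg : E4 → A.domain := fun x ↦ g (Φ x) with hΨg
  set Θ : E4 → E4 := fun x ↦ ((Ψg x : A.domain) : E4) with hΘ
  have hΘeq : ∀ x ∈ S, kerrChartMap A Ψ x = Θ x := fun x hx ↦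
    chartPreimage_eq_symm A (hΦr hx)
  have hΘev : ∀ x ∈ S, kerrChartMap A Ψ =ᶠ[𝓝 x] Θ := fun x hx ↦
    Filter.eventuallyEq_of_mem (hSo.mem_nhds hx) fun y hy ↦ hΘeq y hy
  have hAΨ : ∀ x ∈ S, A.toFun (Ψg x) = Φ x := fun x hx ↦ hAg _ (hΦr hx)
  -- smoothness
  have hΨgs : ContMDiffOn 𝓘(ℝ, E4) 𝓘(ℝ, E4) ∞ Ψg S := hgs.comp hΦs hΦr
  have hΘs : ContMDiffOn 𝓘(ℝ, E4) 𝓘(ℝ, E4) ∞ Θ S := contMDiff_subtype_val.comp_contMDiffOn hΨgs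
  have hΘs' : ContDiffOn ℝ ∞ Θ S := contMDiffOn_iff_contDiffOn.mp hΘs
  have hΨgd : ∀ x ∈ S, MDifferentiableAt 𝓘(ℝ, E4) 𝓘(ℝ, E4) Ψg x := fun x hx ↦
    (hΨgs.contMDiffAt (hSo.mem_nhds hx)).mdifferentiableAt (by simp)
  -- chain rule `dA ∘ dΨg = dΦ` on `S`
  have hchain : ∀ x ∈ S, ∀ v : E4,
      mfderiv 𝓘(ℝ, E4) (𝓡 4) A.toFun (Ψg x) (mfderiv 𝓘(ℝ, E4) 𝓘(ℝ, E4) Ψg x v) =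
        mfderiv 𝓘(ℝ, E4) (𝓡 4) Φ x v := by
    intro x hx v
    have hAx : MDifferentiableAt 𝓘(ℝ, E4) (𝓡 4) A.toFun (Ψg x) :=
      A.contMDiff.mdifferentiableAt (by simp)
    have hcomp := mfderiv_comp x hAx (hΨgd x hx)
    have hev : (A.toFun ∘ Ψg) =ᶠ[𝓝 x] Φ :=
      Filter.eventuallyEq_of_mem (hSo.mem_nhds hx) fun y hy ↦ hAΨ y hy
    rw [hev.mfderiv_eq] at hcomp
    rw [hcomp]
    rfl
  -- `dΘ = dΨg`
  have hΘΨ : ∀ x ∈ S, ∀ v : E4, fderiv ℝ Θ x v = mfderiv 𝓘(ℝ, E4) 𝓘(ℝ, E4) Ψg x v := by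
    intro x hx v
    have h := mfderiv_comp x (OpenSubmanifold.mdifferentiableAt_subtype_val (I := 𝓘(ℝ, E4)) (Ψg x))
      (hΨgd x hx)
    rw [OpenSubmanifold.mfderiv_subtype_val] at h
    have h' : mfderiv 𝓘(ℝ, E4) 𝓘(ℝ, E4) (Subtype.val ∘ Ψg) x v = mfderiv 𝓘(ℝ, E4) 𝓘(ℝ, E4) Ψg x v := by
      rw [h]
      rfl
    rw [← mfderiv_eq_fderiv]
    exact h'
  have keyT : ∀ p q : 𝓑.carrier, p = q → (𝓑.killing p : E4) = 𝓑.killing q := by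
    rintro p q rfl; rfl
  have keyG : ∀ p q : 𝓑.carrier, p = q → ∀ v w : E4, 𝓑.metric.val p v w = 𝓑.metric.val q v w := by
    rintro p q rfl v w; rfl
  -- injectivity and range
  have hΘinj : Set.InjOn Θ S := by
    intro x hx y hy hxy
    have h1 : Ψg x = Ψg y := Subtype.ext hxy
    have h2 : Φ x = Φ y := by rw [← hAΨ x hx, ← hAΨ y hy, h1]
    exact hΦi hx hy h2
  have hΘmaps : Set.MapsTo Θ S (A.domain : Set E4) := fun x _ ↦ (Ψg x).2
  -- isometry on the exterior
  have hΦiso : ∀ x ∈ S, ∀ v w : E4,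
      𝓑.metric.val (Φ x) (mfderiv 𝓘(ℝ, E4) (𝓡 4) Φ x v) (mfderiv 𝓘(ℝ, E4) (𝓡 4) Φ x w) =
        Kerr.bilin M a x v w := by
    intro x hx v w
    have h := DFunLike.congr_fun (DFunLike.congr_fun (hΨiso.2 ⟨x, hx⟩) v) w
    have h' : 𝓑.metric.val (Ψ ⟨x, hx⟩) (mfderiv 𝓘(ℝ, E4) (𝓡 4) Ψ ⟨x, hx⟩ v)
        (mfderiv 𝓘(ℝ, E4) (𝓡 4) Ψ ⟨x, hx⟩ w) = Kerr.bilin M a x v w := h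
    rw [← hΦmf ⟨x, hx⟩ v, ← hΦmf ⟨x, hx⟩ w] at h'
    rw [keyG _ _ (kerrExtend_apply Ψ ⟨x, hx⟩)]
    exact h'
  have hΘiso : ∀ x ∈ S, ∀ v w : E4,
      A.bilin (Θ x) (fderiv ℝ Θ x v) (fderiv ℝ Θ x w) = Kerr.bilin M a x v w := by
    intro x hx v w
    rw [show Θ x = (Ψg x).1 from rfl, A.bilin_eq (Ψg x)]
    change 𝓑.metric.val (A.toFun (Ψg x)) (mfderiv 𝓘(ℝ, E4) (𝓡 4) A.toFun (Ψg x) (fderiv ℝ Θ x v))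
      (mfderiv 𝓘(ℝ, E4) (𝓡 4) A.toFun (Ψg x) (fderiv ℝ Θ x w)) = _
    rw [hΘΨ x hx v, hΘΨ x hx w, hchain x hx v, hchain x hx w, keyG _ _ (hAΨ x hx)]
    exact hΦiso x hx v w
  -- anchoring
  have hΦdoc : Φ '' S = 𝓑.doc := by rw [hS, hΦ_def, kerrExtend_image, hΨr]
  have hΘanchor : Θ '' S = {u : E4 | ∃ h : u ∈ A.domain, A.toFun ⟨u, h⟩ ∈ 𝓑.doc} := by
    ext u
    constructor
    · rintro ⟨x, hx, rfl⟩
      refine ⟨(Ψg x).2, ?_⟩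
      rw [Subtype.coe_eta, hAΨ x hx, ← hΦdoc]
      exact Set.mem_image_of_mem Φ hx
    · rintro ⟨hu, hdoc⟩
      rw [← hΦdoc] at hdoc
      obtain ⟨x, hx, hxu⟩ := hdoc
      refine ⟨x, hx, ?_⟩
      have h : Ψg x = ⟨u, hu⟩ := by rw [hΨg]; dsimp only; rw [hxu, hgA]
      rw [hΘ]; dsimp only; rw [h]
  -- `DΘ (Y) = e₀`
  have hΘY : ∀ x : Kerr.exterior M a,
      fderiv ℝ Θ x.1 (VectorField.mpullback 𝓘(ℝ, E4) (𝓡 4) Ψ 𝓑.killing x) = E4.basisVector 0 := by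
    intro x
    rw [hΘΨ x.1 x.2]
    apply hA (Ψg x.1)
    rw [hchain x.1 x.2, hΦmf x, A.mfderiv_toFun_basisVector (Ψg x.1), keyT _ _ (hAΨ x.1 x.2),
      show Φ x.1 = Ψ x from kerrExtend_apply Ψ x]
    exact PseudoRiemannianMetric.mfderiv_mpullback_apply (I := 𝓡 4) (I' := 𝓘(ℝ, E4))
      (M := 𝓑.carrier) (N := Kerr.region a (Kerr.rPlus M a)) (Φ := Ψ) hΨiso.injective_mfderiv rfl
      𝓑.killing x
  -- transfer to the explicit map
  refine ⟨hΘs'.congr hΘeq, fun x hx y hy hxy ↦ hΘinj hx hy (by rwa [← hΘeq x hx, ← hΘeq y hy]),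
    fun x hx ↦ show kerrChartMap A Ψ x ∈ (A.domain : Set E4) by rw [hΘeq x hx]; exact hΘmaps hx,
    fun x hx v w ↦ ?_, ?_, fun x ↦ ?_, fun x ↦ ?_⟩
  · rw [(hΘev x hx).fderiv_eq, hΘeq x hx]
    exact hΘiso x hx v w
  · rw [← hΘanchor]
    exact Set.image_congr fun x hx ↦ hΘeq x hx
  · refine ⟨by rw [hΘeq x.1 x.2]; exact hΘmaps x.2, ?_⟩
    have h1 : (⟨kerrChartMap A Ψ x.1, by rw [hΘeq x.1 x.2]; exact hΘmaps x.2⟩ : A.domain) = Ψg x.1 :=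
      Subtype.ext (hΘeq x.1 x.2)
    rw [h1, hAΨ x.1 x.2]
    exact kerrExtend_apply Ψ x
  · rw [(hΘev x.1 x.2).fderiv_eq]
    exact hΘY x

end ChartMap


/-! ## §2 The chart preimage `P` of the d.o.c.: time invariance, far cylinder, non-triviality -/

section ChartDoc

variable {𝓑 : StationaryAFBlackHole.{0}} (A : 𝓑.AdaptedChart)

/-- The **chart preimage of the d.o.c.** under the adapted chart `A`:
`P = {u ∈ A.domain | A u ∈ ⟨⟨M_ext⟩⟩}` (the anchoring set of `IsKerrCharted(With)`). Chruściel–Costa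
arXiv:0806.0016, (2.2). [folklore] -/
def chartDoc : Set E4 := {u : E4 | ∃ h : u ∈ A.domain, A.toFun ⟨u, h⟩ ∈ 𝓑.doc}

/-- `(t, y) + s e₀ = (t + s, y)`. [folklore] -/
theorem _root_.Literature.Geometry.Lorentzian.E4.ofTimeSpace_add_smul (t : ℝ) (y : E3) (s : ℝ) :
    E4.ofTimeSpace t y + s • E4.basisVector 0 = E4.ofTimeSpace (t + s) y := by
  ext i
  refine Fin.cases ?_ (fun j ↦ ?_) i
  · simp
  · simp [Fin.succ_ne_zero]

/-- The chart domain is invariant under chart-time translation (`AdaptedChart.mem_domain_ofTimeSpace`).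
[folklore] -/
theorem add_smul_basisVector_mem_domain {u : E4} (hu : u ∈ A.domain) (s : ℝ) :
    u + s • E4.basisVector 0 ∈ A.domain := by
  have h := A.mem_domain_ofTimeSpace (E4.time u) (E4.time u + s) (E4.spatial u)
    (by rwa [E4.ofTimeSpace_time_spatial])
  rwa [← E4.ofTimeSpace_add_smul, E4.ofTimeSpace_time_spatial] at h

/-- **The chart lines are integral curves of `T`.** For `u ∈ A.domain` the curve
`s ↦ A (u + s e₀)` is a whole-line integral curve of the stationary Killing field (`dA e₀ = T`,
`AdaptedChart.mfderiv_toFun_basisVector`, and the chain rule through the open submanifold `A.domain`).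
Alexakis–Ionescu–Klainerman arXiv:0904.0982, §1.1 (`T = ∂₀`). [folklore] -/
theorem isMIntegralCurve_adaptedChart_line {u : E4} (hu : u ∈ A.domain) :
    IsMIntegralCurve (fun s : ℝ ↦ A.toFun ⟨u + s • E4.basisVector 0, add_smul_basisVector_mem_domain A hu s⟩)
      𝓑.killing := by
  intro t
  set c : ℝ → A.domain := fun s ↦ ⟨u + s • E4.basisVector 0, add_smul_basisVector_mem_domain A hu s⟩
    with hc
  have h1 : HasDerivAt (fun s : ℝ ↦ u + s • E4.basisVector 0) (E4.basisVector 0) t := by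
    simpa using ((hasDerivAt_id t).smul_const (E4.basisVector 0)).const_add u
  have h2 : HasMFDerivAt 𝓘(ℝ, ℝ) 𝓘(ℝ, E4) (fun s : ℝ ↦ u + s • E4.basisVector 0) t
      ((1 : ℝ →L[ℝ] ℝ).smulRight (E4.basisVector 0)) :=
    hasMFDerivAt_iff_hasFDerivAt.2 h1.hasFDerivAt
  have h3 : HasMFDerivAt 𝓘(ℝ, ℝ) 𝓘(ℝ, E4) c t ((1 : ℝ →L[ℝ] ℝ).smulRight (E4.basisVector 0)) :=
    OpensChart.hasMFDerivAt_codRestrict (fun _ ↦ rfl) h2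
  have h4 : HasMFDerivAt 𝓘(ℝ, E4) (𝓡 4) A.toFun (c t) (mfderiv 𝓘(ℝ, E4) (𝓡 4) A.toFun (c t)) :=
    (A.contMDiff.mdifferentiableAt (by simp)).hasMFDerivAt
  have h5 := h4.comp t h3
  have heq : (mfderiv 𝓘(ℝ, E4) (𝓡 4) A.toFun (c t)).comp ((1 : ℝ →L[ℝ] ℝ).smulRight (E4.basisVector 0)) =
      (1 : ℝ →L[ℝ] ℝ).smulRight (𝓑.killing (A.toFun (c t))) := by
    apply ContinuousLinearMap.ext_ring
    change mfderiv 𝓘(ℝ, E4) (𝓡 4) A.toFun (c t) ((1 : ℝ) • E4.basisVector 0) =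
      (1 : ℝ) • 𝓑.killing (A.toFun (c t))
    rw [one_smul, one_smul]
    exact A.mfderiv_toFun_basisVector (c t)
  exact h5.congr_mfderiv heq

/-- **`P` is invariant under chart-time translation**: the chart line through a point of `P` is an
integral curve of `T` starting in the d.o.c., hence stays in it (`mem_doc_of_isMIntegralCurve`).
Chruściel–Costa arXiv:0806.0016, §2.2. [folklore] -/
theorem add_smul_basisVector_mem_chartDoc {u : E4} (hu : u ∈ chartDoc A) (s : ℝ) :
    u + s • E4.basisVector 0 ∈ chartDoc A := by
  haveI : 𝓑.metric.HasLeviCivita := 𝓑.metric.toPseudoRiemannianMetric.hasLeviCivita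
  obtain ⟨hud, hdoc⟩ := hu
  refine ⟨add_smul_basisVector_mem_domain A hud s, ?_⟩
  have h0 : (fun s : ℝ ↦ A.toFun ⟨u + s • E4.basisVector 0, add_smul_basisVector_mem_domain A hud s⟩) 0 ∈
      𝓑.doc := by
    have he : (⟨u + (0 : ℝ) • E4.basisVector 0, add_smul_basisVector_mem_domain A hud 0⟩ : A.domain) =
        ⟨u, hud⟩ := Subtype.ext (by simp)
    simp only [he]
    exact hdoc
  exact StationaryAFBlackHole.mem_doc_of_isMIntegralCurve (isMIntegralCurve_adaptedChart_line A hud) h0 s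

/-- `P` is invariant under chart-time translation (iff form). [folklore] -/
theorem add_smul_basisVector_mem_chartDoc_iff (u : E4) (s : ℝ) :
    u + s • E4.basisVector 0 ∈ chartDoc A ↔ u ∈ chartDoc A := by
  refine ⟨fun h ↦ ?_, fun h ↦ add_smul_basisVector_mem_chartDoc A h s⟩
  have h' := add_smul_basisVector_mem_chartDoc A h (-s)
  rwa [add_assoc, ← add_smul, add_neg_cancel, zero_smul, add_zero] at h'

/-- **The far cylinder lies in `P`** for an asymptotically Schwarzschildean chart: clause (i) of
`ChartIsAsymptoticallySchwarzschildean'` charts the far leaf points `(0, y)`, `‖y‖ ≥ R₀`, into the d.o.c., and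
`(t, y) = (0, y) + t e₀`. [folklore] -/
theorem mem_chartDoc_of_le_spatialNorm (h : ChartIsAsymptoticallySchwarzschildean' A) :
    ∃ R₀ : ℝ, ∀ u : E4, R₀ ≤ E4.spatialNorm u → u ∈ chartDoc A := by
  obtain ⟨-, -, R₀, hfar, -⟩ := h
  refine ⟨R₀, fun u hu ↦ ?_⟩
  rw [← ofTimeSpace_zero_spatial_add_time_smul u]
  exact add_smul_basisVector_mem_chartDoc A (hfar (E4.spatial u) hu) (E4.time u)

/-- **`P` is not all of `E4`** when the (non-empty) future event horizon is charted by `A`: a chart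
preimage of a horizon point is not in `P`, the horizon being disjoint from the d.o.c.
(`disjoint_horizon_doc`). Chruściel–Costa arXiv:0806.0016, §2.2. [folklore] -/
theorem compl_chartDoc_nonempty (hne : 𝓑.horizon.Nonempty) (hhor : 𝓑.horizon ⊆ Set.range A.toFun) :
    (chartDoc A)ᶜ.Nonempty := by
  obtain ⟨p, hp⟩ := hne
  obtain ⟨u, rfl⟩ := hhor hp
  refine ⟨u.1, fun ⟨hu, hdoc⟩ ↦ ?_⟩
  rw [Subtype.coe_eta] at hdoc
  exact Set.disjoint_left.1
    (𝓑.disjoint_horizon_doc LorentzianMetric.isOpen_chronologicalPast_holds_of_boundaryless) hp hdoc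

end ChartDoc

end Summit.FinalStateConjecture.FinalStateConjecture.Theorems.SymplecticDualOfTheBomb

end
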